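import Literature.AlgebraicGeometry.HodgeTheory.MotivatedClassesAlgebraic
import Literature.AlgebraicGeometry.HodgeTheory.ComplexGysinCorrespondence
import Literature.AlgebraicGeometry.HodgeTheory.GysinProjectionNonvanishing
import Literature.AlgebraicTopology.SingularHomology.CupProductProofs
import HarnessLib

/-!
# Route HeckePrymWeil — `SummitOffWeilSector` (stmt-HodgeConjecture-14374), line `motivated-anchor-split`: instances of the standard conjecture of Lefschetz type `B` in André's `*_L`-form

Stub `stub_lefschetzStandardB` of the line asks for Grothendieck's standard conjecture of Lefschetz
type for EVERY smooth projective complex variety, in André's form on the real carriers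
(`StandardConjectureBStar d Z η`: for a polarisation class `η` of the `d`-fold `Z`, every Lefschetz
involution `*_L : Hᵃ(Z(ℂ); ℂ) → Hᵇ(Z(ℂ); ℂ)`, `a + b = 2d`, is induced by an algebraic class on
`Z × Z`, `IsAlgebraicCorrespondence`). That is an OPEN CONJECTURE; this file lands the part of it
that is a THEOREM on the tree's carriers, as a typing test of the real-carrier statement (the
"cheapest falsifier" of the line card: were the orientation / degree conventions of `corrClassAction`
junk, already the identity would fail to be an algebraic correspondence):

* `standardConjectureBStar_middleDegree` — the MIDDLE degree `a = b = n` for every smooth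
  projective `X` of dimension `n`: there `*_L = L⁰ = 𝟙 = (𝟙 X)^* = [Γ_𝟙]^* = [Δ]^*`
  (`lefschetzInvolution_apply_of_le`, `isAlgebraicCorrespondence_map`);
* `isAlgebraicCorrespondence_cupProduct_right`, `isAlgebraicCorrespondence_lefschetzOperator` — cup
  product with an ALGEBRAIC class `γ₀ ∈ Nʲ H²ʲ(X(ℂ))` is an algebraic correspondence, induced by
  `Δ_* γ₀ ∈ N^{n+j} H^{2n+2j}((X ⊗ X)(ℂ))` (projection formula for the diagonal); in particular the
  Lefschetz operator `L = η ∪ ·` of a class `η ∈ N¹ H²`, whence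
  `standardConjectureBStar_of_succ_eq` — the degree `(n - 1, n + 1)`, where `*_L = L`;
* `isAlgebraicCorrespondence_of_topDegree` — EVERY linear map `H²ⁿ(X(ℂ); ℂ) → H⁰(X(ℂ); ℂ)` is an
  algebraic correspondence (both spaces are lines, Hatcher Thm. 3.26, and the correspondence
  `1 ∈ N⁰ H⁰((X ⊗ X)(ℂ))` acts as the fibre integral `pr₁_* pr₂^*`, non-zero on the top class,
  `complexGysin_fst_map_snd_ne_zero`), whence `standardConjectureBStar_of_eq_top` — the degree
  `(2n, 0)`, where `*_L = (Lⁿ)⁻¹`;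
* `lefschetzStandardB_dim_zero`, `lefschetzStandardB_dim_one` — hence the FULL statement
  `StandardConjectureBStar d Z η` for `d = 0` (only the degree pair `(0, 0)`) and for `d = 1`, i.e.
  **conjecture `B` for all smooth projective complex curves** (degree pairs `(0, 2)`: `*_L = L`;
  `(1, 1)`: `*_L = 𝟙`; `(2, 0)`: `*_L = L⁻¹`), unconditionally — the classical trivial cases of
  `B(X)` (Grothendieck 1968 §3; André 1996 §0.3).

What is NOT here (and why the stub stays conjecture-grade): for `d ≥ 2` the degrees `a ≤ d - 2`
(`*_L = L^{d-a}` needs `η^{d-a}` algebraic, i.e. the cup product of algebraic classes — the line's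
Stub 4, not assumed here) and, decisively, the degrees `d < a < 2d` (`*_L` = INVERSE Lefschetz
isomorphisms, the content of `B(X)`; open beyond surfaces, abelian varieties, flag varieties, …).
-/

noncomputable section

-- every declaration of this problem lives in `Summit.HodgeConjecture.HodgeConjecture.…` (summit = sub-problem)
set_option linter.dupNamespace false

open CategoryTheory AlgebraicGeometry MonoidalCategory CartesianMonoidalCategory
open Literature.AlgebraicGeometry.Motives Literature.AlgebraicGeometry.HodgeTheory
open Literature.AlgebraicTopology.SingularHomology Literature.Geometry.Kaehler

namespace Summit.HodgeConjecture.HodgeConjecture.Theorems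

variable {n : ℕ} {X : SchemeOver ℂ}

/-! ### The middle degree: `*_L = 𝟙` -/

/-- In the middle degree `a = b = n` André's Lefschetz involution of an `n`-fold is `L⁰ = 𝟙`
("donnée en chaque degré par l'isomorphisme de Lefschetz `L^{d-i}`", here `d - i = 0`), written as
the pull-back `(𝟙 X)^*`. [cite: Andre1996Motifs, §0.2 (p. 7) and §1.1 (p. 10)] -/
theorem lefschetzInvolution_middleDegree_eq_map_id {η : complexBetti X 2}
    (hL : HasHardLefschetzProperty η n) (hab : n + n = 2 * n) :
    lefschetzInvolution hL hab = (complexBetti.map (𝟙 X) n).hom := by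
  rw [complexBetti.map_id]
  refine LinearMap.ext fun x ↦ ?_
  have h := lefschetzInvolution_apply_of_le hL (a := n) (j := 0) (by omega) hab x
  rw [lefschetzPow_zero, LinearMap.id_apply] at h
  rw [h]
  rfl

/-- **`B(X)` in the middle degree, for every smooth projective complex variety.** For `X` smooth
projective of dimension `n` and a polarisation class `η`, the Lefschetz involution
`*_L : Hⁿ(X(ℂ); ℂ) → Hⁿ(X(ℂ); ℂ)` is induced by an algebraic correspondence: `*_L = L⁰ = 𝟙 = (𝟙 X)^*`,
and `f^*` is the action of the (algebraic) graph class `[Γ_f] = (𝟙, f)_* 1`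
(`isAlgebraicCorrespondence_map`, André §2.1 p. 15), here the diagonal `[Δ] ∈ Nⁿ H²ⁿ((X ⊗ X)(ℂ))`.
Unconditional: complex-point manifolds are orientable and every orientation family has Poincaré
duality (`OrientationFamily.hasPoincareDuality`). [cite: Andre1996Motifs, §0.2–0.3 (pp. 7–8) and §2.1 (p. 15)]
[cite: Grothendieck1968, §3 p. 196 (B(X))] -/
theorem standardConjectureBStar_middleDegree (hX : IsSmoothProjective n X) {η : complexBetti X 2}
    (hη : IsPolarizationClass n X η) (hab : n + n = 2 * n) :
    IsAlgebraicCorrespondence n n X X (lefschetzInvolution hη.hasHardLefschetz hab) := by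
  rw [lefschetzInvolution_middleDegree_eq_map_id hη.hasHardLefschetz hab]
  exact isAlgebraicCorrespondence_map hX hX (𝟙 X) (by omega)

/-- `B(X)` in the middle degree, binder form of `StandardConjectureBStar`: for `a + b = 2n` with
`a = n`, `*_L : Hᵃ → Hᵇ` is induced by an algebraic correspondence.
[cite: Andre1996Motifs, §0.2–0.3 (pp. 7–8)] [cite: Grothendieck1968, §3 p. 196 (B(X))] -/
theorem standardConjectureBStar_of_eq_middle (hX : IsSmoothProjective n X) {η : complexBetti X 2}
    (hη : IsPolarizationClass n X η) {a b : ℕ} (hab : a + b = 2 * n) (ha : a = n) :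
    IsAlgebraicCorrespondence n n X X (lefschetzInvolution hη.hasHardLefschetz hab) := by
  subst ha
  obtain rfl : b = a := by omega
  exact standardConjectureBStar_middleDegree hX hη hab

/-! ### Cup product with an algebraic class is an algebraic correspondence: `(· ∪ γ₀) = [Δ_* γ₀]^*` -/

/-- **Cup product with an algebraic class is induced by an algebraic correspondence.** For `X`
smooth projective of dimension `n`, `γ₀ ∈ Nʲ H²ʲ(X(ℂ); ℂ) = algebraicClasses X j` and `a + 2j = b ≤ 2n`,
the map `c ↦ c ∪ γ₀ : Hᵃ(X(ℂ); ℂ) → Hᵇ(X(ℂ); ℂ)` is `[Δ_* γ₀]^*` for the diagonal `Δ : X → X ⊗ X`: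
`pr₁_*(pr₂^* c ∪ Δ_* γ₀) = pr₁_* Δ_*(Δ^* pr₂^* c ∪ γ₀) = (Δ ≫ pr₁)_*(c ∪ γ₀) = c ∪ γ₀` (projection
formula and functoriality of Gysin maps, Fulton App. B (2), (5), (6): the tree's `complexGysin_cup`,
`complexGysin_comp`, `complexGysin_id`), and `Δ_* γ₀ ∈ N^{n+j} H^{2(n+j)}((X ⊗ X)(ℂ))` (Gysin images
of supported classes are supported on the image, `complexGysin_mem_supportedClasses`, Fulton App. B
§B.2 Ex. 5). [cite: VoisinHodgeII2003, proof of Thm. 10.17 (10.7)]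
[cite: FultonYoungTableaux1997, Appendix B §B.1 (2), (5), (6) and §B.2 Exercise 5] -/
theorem isAlgebraicCorrespondence_cupProduct_right (hX : IsSmoothProjective n X) {j a b : ℕ}
    (hab : a + 2 * j = b) (hb : b ≤ 2 * n) {γ₀ : complexBetti X (2 * j)}
    (hγ₀ : γ₀ ∈ algebraicClasses X j) :
    IsAlgebraicCorrespondence n n X X ((cupProduct hab).flip γ₀) := by
  obtain ⟨μ, hμ⟩ : ∃ μ : OrientationFamily, μ.HasPoincareDuality :=
    ⟨fun _ _ h ↦ Classical.choice (ComplexPoints.isOrientableOver ℂ h),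
      OrientationFamily.hasPoincareDuality _⟩
  have hXX : IsSmoothProjective (n + n) (X ⊗ X) := IsSmoothProjective.tensor_holds hX hX
  -- the diagonal, a section of both projections
  obtain ⟨Δ, hΔfst, hΔsnd⟩ : ∃ Δ : X ⟶ X ⊗ X, Δ ≫ fst X X = 𝟙 X ∧ Δ ≫ snd X X = 𝟙 X :=
    ⟨lift (𝟙 X) (𝟙 X), lift_fst _ _, lift_snd _ _⟩
  have hΔdeg : 2 * j + 2 * (n + n) = 2 * (n + j) + 2 * n := by omega
  have hab' : a + 2 * (n + j) = b + 2 * n := by omega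
  -- `(· ∪ γ₀) = [Δ_* γ₀]^*`
  have key : (cupProduct hab).flip γ₀ =
      corrAction μ hX hX hab' (complexGysin μ hX hXX Δ hΔdeg γ₀) := by
    refine LinearMap.ext fun c ↦ ?_
    rw [LinearMap.flip_apply, corrAction_apply]
    -- projection formula for `Δ`: `pr₂^* c ∪ Δ_* γ₀ = Δ_* (Δ^* pr₂^* c ∪ γ₀)`
    rw [← complexGysin_cup hμ hX hXX Δ hab
      (show b + 2 * (n + n) = a + 2 * (n + j) + 2 * n by omega) hΔdeg rfl
      (complexBetti.map (snd X X) a c) γ₀]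
    -- `Δ^* pr₂^* c = (Δ ≫ pr₂)^* c = c`
    have hc : (complexBetti.map Δ a) ((complexBetti.map (snd X X) a) c) = c := by
      have h := (CategoryTheory.comp_apply (complexBetti.map (snd X X) a)
        (complexBetti.map Δ a) c).symm
      rw [← complexBetti.map_comp, hΔsnd, complexBetti.map_id] at h
      exact h
    rw [hc]
    -- `pr₁_* ∘ Δ_* = (Δ ≫ pr₁)_* = (𝟙 X)_* = 𝟙`
    have hcomp := complexGysin_comp hμ hX hXX hX Δ (fst X X)
      (show b + 2 * (n + n) = a + 2 * (n + j) + 2 * n by omega) (corrAction_degree n hab')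
    rw [hΔfst, complexGysin_id hμ hX b] at hcomp
    have h := LinearMap.congr_fun hcomp (cupProduct hab c γ₀)
    rw [LinearMap.comp_apply, LinearMap.id_apply] at h
    exact h
  rw [key]
  exact isAlgebraicCorrespondence_corrAction μ hμ hX hX hab' (show b + (2 * n - b) = 2 * n by omega)
    (complexGysin_mem_supportedClasses (gysinMap_restrictCompl_eq_zero_of_field ℂ) μ hμ hX hXX Δ
      hΔdeg (by omega) hγ₀)

/-- **The Lefschetz operator of a divisor-supported class is an algebraic correspondence.** For `X`
smooth projective of dimension `n`, `η ∈ N¹ H²(X(ℂ); ℂ) = algebraicClasses X 1` and `2 + a = b ≤ 2n`,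
`L = η ∪ · : Hᵃ(X(ℂ); ℂ) → Hᵇ(X(ℂ); ℂ)` (`lefschetzOperator`) is induced by an algebraic
correspondence: `η ∪ c = c ∪ η` (graded commutativity, `η` of even degree; Hatcher Thm. 3.11, the
tree's `cupProduct_gradedComm_holds`) and `isAlgebraicCorrespondence_cupProduct_right` (`[Δ_* η]^*`).
André §1.1: "`L = L_η` l'opérateur de Lefschetz sur `H(X)` défini par le cup-produit avec `η`" is
algebraic. [cite: Andre1996Motifs, §1.1 (p. 10)] [cite: HatcherAT2002, §3.2 Thm. 3.11]
[cite: VoisinHodgeII2003, proof of Thm. 10.17 (10.7)] -/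
theorem isAlgebraicCorrespondence_lefschetzOperator (hX : IsSmoothProjective n X)
    {η : complexBetti X 2} (hη : η ∈ algebraicClasses X 1) {a b : ℕ} (h : 2 + a = b)
    (hb : b ≤ 2 * n) : IsAlgebraicCorrespondence n n X X (lefschetzOperator η h) := by
  have hab : a + 2 * 1 = b := by omega
  have heq : lefschetzOperator η h = (cupProduct hab).flip η := by
    refine LinearMap.ext fun c ↦ ?_
    rw [lefschetzOperator_apply, LinearMap.flip_apply, cupProduct_gradedComm_holds ℂ _ h hab η c,
      (even_two_mul a).neg_one_pow, one_smul]
  rw [heq]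
  exact isAlgebraicCorrespondence_cupProduct_right hX hab hb hη

/-- **`B(X)` in the degree just below the middle, for every smooth projective complex variety.**
For `X` smooth projective of dimension `n`, a polarisation class `η` and `a + 1 = n`, `a + b = 2n`
(so `b = a + 2`), the Lefschetz involution `*_L : Hᵃ(X(ℂ); ℂ) → Hᵇ(X(ℂ); ℂ)` is `L¹ = η ∪ ·`
(`lefschetzInvolution_apply_of_le`), an algebraic correspondence since `η ∈ N¹ H²` is supported on a
divisor (`IsPolarizationClass.mem_algebraicClasses`, `isAlgebraicCorrespondence_lefschetzOperator`).
[cite: Andre1996Motifs, §0.2–0.3 (pp. 7–8) and §1.1 (p. 10)] [cite: Grothendieck1968, §3 p. 196 (B(X))] -/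
theorem standardConjectureBStar_of_succ_eq (hX : IsSmoothProjective n X) {η : complexBetti X 2}
    (hη : IsPolarizationClass n X η) {a b : ℕ} (ha : a + 1 = n) (hab : a + b = 2 * n) :
    IsAlgebraicCorrespondence n n X X (lefschetzInvolution hη.hasHardLefschetz hab) := by
  obtain rfl : b = a + 2 * 1 := by omega
  have heq : lefschetzInvolution hη.hasHardLefschetz hab =
      lefschetzOperator η (show 2 + a = a + 2 * 1 by omega) := by
    refine LinearMap.ext fun c ↦ ?_
    rw [lefschetzInvolution_apply_of_le hη.hasHardLefschetz ha hab c]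
    rfl
  rw [heq]
  exact isAlgebraicCorrespondence_lefschetzOperator hX hη.mem_algebraicClasses _ (by omega)

/-! ### The degree pair `(2n, 0)`: every linear map `H²ⁿ → H⁰` is an algebraic correspondence -/

/-- **Every linear map `H²ⁿ(X(ℂ); ℂ) → H⁰(X(ℂ); ℂ)` is induced by an algebraic correspondence**, for
`X` smooth projective of dimension `n`. Both spaces are lines — `H⁰(X(ℂ)) = ℂ · 1` and
`H²ⁿ(X(ℂ)) = ℂ · w₁` for any `w₁ ≠ 0` (`X(ℂ)` is a closed connected oriented `2n`-manifold; Hatcher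
Thm. 3.26 with universal coefficients; the tree's `exists_eq_smul_one`, `exists_eq_smul_of_top`) —
and the algebraic class `1 ∈ N⁰ H⁰((X ⊗ X)(ℂ)) = H⁰` acts as the fibre integral
`1^* = pr₁_*(pr₂^*(·) ∪ 1) = pr₁_* pr₂^*`, which does not vanish on `w₁`
(`complexGysin_fst_map_snd_ne_zero`, Fulton App. B (7)); so `T = t • 1^* = (t • 1)^*` for a scalar
`t`. [cite: HatcherAT2002, §3.3 Thm. 3.26] [cite: FultonYoungTableaux1997, Appendix B §B.1 (5)–(7)]
[cite: VoisinHodgeII2003, proof of Thm. 10.17 (10.7)] -/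
theorem isAlgebraicCorrespondence_of_topDegree (hX : IsSmoothProjective n X)
    (T : complexBetti X (2 * n) →ₗ[ℂ] complexBetti X 0) : IsAlgebraicCorrespondence n n X X T := by
  obtain ⟨μ, hμ⟩ : ∃ μ : OrientationFamily, μ.HasPoincareDuality :=
    ⟨fun _ _ h ↦ Classical.choice (ComplexPoints.isOrientableOver ℂ h),
      OrientationFamily.hasPoincareDuality _⟩
  have hXX : IsSmoothProjective (n + n) (X ⊗ X) := IsSmoothProjective.tensor_holds hX hX
  have hdeg : 2 * n + 2 * n = 0 + 2 * (n + n) := by omega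
  -- `P = pr₁_* pr₂^* : H²ⁿ(X(ℂ)) → H⁰(X(ℂ))`
  obtain ⟨P, hP⟩ : ∃ P : complexBetti X (2 * n) →ₗ[ℂ] complexBetti X 0,
      P = complexGysin μ hXX hX (fst X X) hdeg ∘ₗ (complexBetti.map (snd X X) (2 * n)).hom :=
    ⟨_, rfl⟩
  -- `T = t • P`: two linear maps between lines, the second non-zero
  obtain ⟨t, ht⟩ : ∃ t : ℂ, T = t • P := by
    by_cases h0 : ∀ w : complexBetti X (2 * n), w = 0
    · exact ⟨0, LinearMap.ext fun w ↦ by rw [h0 w, map_zero, map_zero]⟩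
    push Not at h0
    obtain ⟨w₁, hw₁⟩ := h0
    have hPw₁ : P w₁ ≠ 0 := by
      rw [hP]
      exact complexGysin_fst_map_snd_ne_zero μ hX hX hw₁
    obtain ⟨u, hu⟩ := exists_eq_smul_one μ hX (P w₁)
    obtain ⟨v, hv⟩ := exists_eq_smul_one μ hX (T w₁)
    have hu0 : u ≠ 0 := by
      rintro rfl
      exact hPw₁ (by rw [hu, zero_smul])
    refine ⟨v * u⁻¹, LinearMap.ext fun w ↦ ?_⟩
    obtain ⟨s, rfl⟩ := exists_eq_smul_of_top μ hX hw₁ w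
    rw [map_smul, hv, LinearMap.smul_apply, map_smul, hu]
    simp only [smul_smul]
    congr 1
    field_simp
  -- `T = (t • 1)^*`
  have hab : 2 * n + 2 * 0 = 0 + 2 * n := by omega
  have hone : ∀ (h : 2 * n + 2 * 0 = 2 * n + 2 * 0) (x : complexBetti (X ⊗ X) (2 * n)),
      cupProduct h x (singularCohomology.one ℂ (ComplexPoints (X ⊗ X))) = x :=
    fun h x ↦ cupProduct_one x
  have key : T = corrAction μ hX hX hab (t • singularCohomology.one ℂ (ComplexPoints (X ⊗ X))) := by
    rw [ht, map_smul]
    congr 1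
    refine LinearMap.ext fun c ↦ ?_
    rw [hP, LinearMap.comp_apply, corrAction_apply, hone]
  rw [key]
  refine isAlgebraicCorrespondence_corrAction μ hμ hX hX hab (show 0 + 2 * n = 2 * n by omega) ?_
  show _ ∈ supportedClasses (X ⊗ X) (2 * 0) 0
  rw [supportedClasses_zero]
  exact Submodule.mem_top

/-- **`B(X)` in the degree pair `(2n, 0)`, for every smooth projective complex variety.** For `X`
smooth projective of dimension `n`, a polarisation class `η` and `a + b = 2n` with `a = 2n` (so
`b = 0`), the Lefschetz involution `*_L : H²ⁿ(X(ℂ); ℂ) → H⁰(X(ℂ); ℂ)` (the inverse of the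
hard-Lefschetz isomorphism `Lⁿ : H⁰ → H²ⁿ`) is induced by an algebraic correspondence — as is every
linear map `H²ⁿ → H⁰` (`isAlgebraicCorrespondence_of_topDegree`).
[cite: Andre1996Motifs, §0.2–0.3 (pp. 7–8)] [cite: Grothendieck1968, §3 p. 196 (B(X))] -/
theorem standardConjectureBStar_of_eq_top (hX : IsSmoothProjective n X) {η : complexBetti X 2}
    (hη : IsPolarizationClass n X η) {a b : ℕ} (hab : a + b = 2 * n) (ha : a = 2 * n) :
    IsAlgebraicCorrespondence n n X X (lefschetzInvolution hη.hasHardLefschetz hab) := by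
  subst ha
  obtain rfl : b = 0 := by omega
  exact isAlgebraicCorrespondence_of_topDegree hX _

/-! ### The full conjecture in dimensions `0` and `1` -/

/-- **Conjecture `B` for zero-dimensional smooth projective complex varieties** (the `d = 0`
instance of the line's stub `stub_lefschetzStandardB`, exact binder shape): for `a + b = 0` the only
degree pair is the middle one `(0, 0)`, where `*_L = 𝟙` (`standardConjectureBStar_of_eq_middle`).
[cite: Andre1996Motifs, §0.2–0.3 (pp. 7–8)] [cite: Grothendieck1968, §3 p. 196 (B(X))] -/
theorem lefschetzStandardB_dim_zero :
    ∀ (Z : SchemeOver ℂ) (η : complexBetti Z 2), IsSmoothProjective 0 Z →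
      StandardConjectureBStar 0 Z η := by
  intro Z η hZ hη a b hab
  exact standardConjectureBStar_of_eq_middle hZ hη hab (by omega)

/-- **Conjecture `B` for smooth projective complex CURVES** (the `d = 1` instance of the line's
stub `stub_lefschetzStandardB`, exact binder shape; the classical trivial case of `B(X)`): for a
polarisation class `η` of the curve `Z` the three Lefschetz involutions are `*_L = L = η ∪ ·` on
`H⁰ → H²` (`standardConjectureBStar_of_succ_eq`: `[Δ_* η]^*`), `*_L = 𝟙` on `H¹ → H¹`
(`standardConjectureBStar_of_eq_middle`: `[Δ]^*`) and `*_L = L⁻¹` on `H² → H⁰`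
(`standardConjectureBStar_of_eq_top`: a multiple of `1^* = pr₁_* pr₂^*`), all induced by algebraic
classes on `Z × Z`. [cite: Grothendieck1968, §3 p. 196 (B(X))] [cite: Andre1996Motifs, §0.2–0.3 (pp. 7–8)] -/
theorem lefschetzStandardB_dim_one :
    ∀ (Z : SchemeOver ℂ) (η : complexBetti Z 2), IsSmoothProjective 1 Z →
      StandardConjectureBStar 1 Z η := by
  intro Z η hZ hη a b hab
  rcases Nat.lt_trichotomy a 1 with ha | rfl | ha
  · obtain rfl : a = 0 := by omega
    exact standardConjectureBStar_of_succ_eq hZ hη (by omega) hab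
  · exact standardConjectureBStar_of_eq_middle hZ hη hab rfl
  · exact standardConjectureBStar_of_eq_top hZ hη hab (by omega)

/-- **The line's stub `stub_lefschetzStandardB` in dimensions `d ≤ 1`** (same binder shape, with the
dimension bound added; registered sub-goal `stub_lefschetzStandardB_dim_le_one` of
stmt-HodgeConjecture-14374): conjecture `B` in André's `*_L`-form for every smooth projective complex
variety of dimension `0` or `1` and every polarisation class. [cite: Grothendieck1968, §3 p. 196 (B(X))]
[cite: Andre1996Motifs, §0.2–0.3 (pp. 7–8)] -/
theorem stub_lefschetzStandardB_dim_le_one :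
    ∀ (d : ℕ) (Z : SchemeOver ℂ) (η : complexBetti Z 2), d ≤ 1 → IsSmoothProjective d Z →
      StandardConjectureBStar d Z η := by
  intro d Z η hd hZ
  interval_cases d
  · exact lefschetzStandardB_dim_zero Z η hZ
  · exact lefschetzStandardB_dim_one Z η hZ

end Summit.HodgeConjecture.HodgeConjecture.Theorems

end
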